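import Literature.Computability.AlgebraicComplexity.SkewCoppersmithWinogradBorderRankProofs
import Mathlib.Analysis.SpecialFunctions.Log.Base
import Mathlib.Analysis.SpecialFunctions.Pow.Real
import HarnessLib

/-!
# The certificate window: how a border-rank bound for one Kronecker power of `T_{cw,q}` becomes a
decimal bound on `ω`, by a decidable integer inequality

`Summits/MatrixMultiplication/MatrixMultiplication/Theorems` (soloist file, blind arm).

The tree proves Conner–Gesmundo–Landsberg–Ventura 2022, Thm. 1.1 (= arXiv:1909.04785 Thm. 1.2;
Coppersmith–Winograd 1990 §6) in border-rank form,
`ω(ℂ) ≤ log_q((4/27) · bR(T_{cw,q}^{⊠k})^{3/k})` (`CGLV2022_thm11_cw_borderRank_form`), and its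
skew-symmetric twin for `T_{skewcw,2u}` (`CGLV2022_skewCw_borderRank_form_holds`).  This file turns
that real-analytic statement into an EVALUATION SCHEME: a certificate `bR(T_{cw,q}^{⊠k}) ≤ r`
together with the integer inequality `(4^k · r^3)^s < q^{k a} · 27^{k s}` (checked by `decide +kernel` /
`norm_num`) gives `ω(ℂ) < a/s` (`soloCW_omega_lt_of_cw_certificate`; the arithmetic core is
`soloCW_lt_of_logb_certificate`: `log_q((4/27) r^{3/k}) < a/s ⟺ ((4/27)^k r^3)^s < q^{k a}`, by
raising to the power `k s`).

Instances at the FIRST OPEN KRONECKER LEVEL `k = 8` of the small tensor `T_{cw,2} ∈ ℂ³⊗ℂ³⊗ℂ³`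
(format `6561 × 6561 × 6561`; trivially `bR ≤ 4^8 = 65536`; `bR ≥ 15·3^6 = 10935` by CGLV Thm. 1.2):
* `soloCW_window_cw_two_pow_eight`: `bR(T_{cw,2}^{⊠8}) ≤ 13029 ⟹ ω(ℂ) < 2.371177`
  (`(4^8·13029^3)^326 < 2^6184·27^2608`, i.e. `ω < 773/326 = 2.37116…`); `2.371177` is the bound
  announced in arXiv:2608.16884 (2026), so `13029` terms is exactly what a decomposition of the
  eighth power must achieve to pass it (`13030` terms give only `log₂((4/27)·13030^{3/8}) = 2.37119…`);
* `soloCW_window_cw_two_pow_eight'`: `bR(T_{cw,2}^{⊠8}) ≤ 13033 ⟹ ω(ℂ) < 2.371339`, the refereed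
  record of Alman–Duan–Vassilevska Williams–Xu–Xu–Zhou (SODA 2025; the tree's named fact
  `advxxz2025_omega_le`), via `(4^8·13033^3)^272 < 2^5160·27^2176` (`ω < 645/272 = 2.37132…`);
* `soloCW_window_skewCw_two_pow_eight`: the same window for `T_{skewcw,2}^{⊠8}`.
Per-level thresholds (largest `r` with `log₂((4/27) r^{3/k}) < 2.371177`, i.e. `r < 3.268634…^k`):
`k = 1…12 ↦ 3, 10, 34, 114, 373, 1219, 3986, 13029, 42589, 139207, 455019, 1487293`; for the record
`2.371339`: `…, 3987, 13033, 42603, 139260, …`.  For `k ≤ 7` these are below the known lower bounds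
(`bR(T_{cw,2}) = 4 > 3`, `bR(T_{cw,2}^{⊠2}) ≥ 15 > 10`, `bR(T_{cw,2}^{⊠3}) ≥ 45 > 34`, and
`15·3^{k-2} > 3.2687^k` for `k ≤ 7`), so `k = 8` is the first level at which CGLV Thm. 1.2 does not
already close the window — whence "first open level".  None of this moves `ω`; it pins, in the kernel,
the number a construction on the Coppersmith–Winograd line has to hit first.

References: A. Conner, F. Gesmundo, J. M. Landsberg, E. Ventura, *Rank and border rank of Kronecker
powers of tensors and Strassen's laser method*, comput. complexity 31 (2022), arXiv:1909.04785,
Thm. 1.1/1.2 (arXiv Thm. 1.2/1.3) and §2.2; D. Coppersmith, S. Winograd, J. Symbolic Comput. 9 (1990),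
§6; J. Alman, R. Duan, V. Vassilevska Williams, Y. Xu, Z. Xu, R. Zhou, *More asymmetry yields faster
matrix multiplication*, SODA 2025 (`ω < 2.371339`); arXiv:2608.16884 (2026; `ω < 2.371177`, as announced).
-/

noncomputable section

namespace Summit.MatrixMultiplication.MatrixMultiplication.Theorems

open Literature.Computability.AlgebraicComplexity

/-- **Arithmetic core of the window.**  If `x ≤ log_Q((4/27) · B^{3/k})` with `1 ≤ B ≤ r`, `Q ≥ 2`,
`k, s ≥ 1`, and the integers satisfy `(4^k r^3)^s < Q^{k a} 27^{k s}`, then `x < a/s`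
(monotonicity of `t ↦ log_Q((4/27) t^{3/k})`, then `log_Q y < a/s ⟺ y^{k s} < Q^{k a}` for `y > 0`).
[folklore] -/
theorem soloCW_lt_of_logb_certificate {Q B r k a s : ℕ} (hQ : 2 ≤ Q) (hk : 1 ≤ k) (hs : 1 ≤ s)
    (hB : 1 ≤ B) (hBr : B ≤ r) {x : ℝ}
    (hx : x ≤ Real.logb Q ((4 / 27) * (B : ℝ) ^ ((3 : ℝ) / k)))
    (hcert : (4 ^ k * r ^ 3) ^ s < Q ^ (k * a) * 27 ^ (k * s)) :
    x < (a : ℝ) / s := by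
  have hQ1 : (1 : ℝ) < Q := by exact_mod_cast hQ
  have hQ0 : (0 : ℝ) ≤ (Q : ℝ) := by positivity
  have hB0 : (0 : ℝ) < B := by exact_mod_cast hB
  have hr1 : 1 ≤ r := le_trans hB hBr
  have hr0 : (0 : ℝ) < r := by exact_mod_cast hr1
  have hk0 : (k : ℝ) ≠ 0 := by exact_mod_cast (show k ≠ 0 by omega)
  have hs0 : (s : ℝ) ≠ 0 := by exact_mod_cast (show s ≠ 0 by omega)
  set X : ℝ := (4 / 27) * (r : ℝ) ^ ((3 : ℝ) / k) with hX
  have hXB : 0 < (4 / 27) * (B : ℝ) ^ ((3 : ℝ) / k) := by positivity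
  have hX0 : 0 < X := by positivity
  -- monotonicity in the border-rank bound
  have h1 : Real.logb Q ((4 / 27) * (B : ℝ) ^ ((3 : ℝ) / k)) ≤ Real.logb Q X := by
    apply Real.logb_le_logb_of_le hQ1 hXB
    have hmono : (B : ℝ) ^ ((3 : ℝ) / k) ≤ (r : ℝ) ^ ((3 : ℝ) / k) :=
      Real.rpow_le_rpow hB0.le (by exact_mod_cast hBr) (by positivity)
    rw [hX]
    exact mul_le_mul_of_nonneg_left hmono (by norm_num)
  -- the certificate: `X < Q^(a/s)`, by comparing `(k s)`-th powers
  have h2 : X < (Q : ℝ) ^ ((a : ℝ) / s) := by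
    refine lt_of_pow_lt_pow_left₀ (k * s) (by positivity) ?_
    have eL : X ^ (k * s) = (4 : ℝ) ^ (k * s) / 27 ^ (k * s) * (r : ℝ) ^ (3 * s) := by
      rw [hX, mul_pow, div_pow]
      congr 1
      rw [← Real.rpow_natCast ((r : ℝ) ^ ((3 : ℝ) / k)) (k * s), ← Real.rpow_mul hr0.le,
        ← Real.rpow_natCast (r : ℝ) (3 * s)]
      congr 1
      push_cast
      rw [div_mul_eq_mul_div, div_eq_iff hk0]
      ring
    have eR : ((Q : ℝ) ^ ((a : ℝ) / s)) ^ (k * s) = (Q : ℝ) ^ (k * a) := by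
      rw [← Real.rpow_natCast ((Q : ℝ) ^ ((a : ℝ) / s)) (k * s), ← Real.rpow_mul hQ0,
        ← Real.rpow_natCast (Q : ℝ) (k * a)]
      congr 1
      push_cast
      rw [div_mul_eq_mul_div, div_eq_iff hs0]
      ring
    have hc : (4 : ℝ) ^ (k * s) * (r : ℝ) ^ (3 * s) < (Q : ℝ) ^ (k * a) * 27 ^ (k * s) := by
      have e1 : (4 ^ k * r ^ 3) ^ s = 4 ^ (k * s) * r ^ (3 * s) := by
        rw [mul_pow, ← pow_mul, ← pow_mul]
      have hc' := hcert
      rw [e1] at hc'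
      exact_mod_cast hc'
    have h27 : (0 : ℝ) < 27 ^ (k * s) := by positivity
    rw [eL, eR, div_mul_eq_mul_div, div_lt_iff₀ h27]
    exact hc
  have h3 : Real.logb Q X < (a : ℝ) / s := (Real.logb_lt_iff_lt_rpow hQ1 hX0).2 h2
  exact lt_of_le_of_lt (hx.trans h1) h3

/-- **Certificate ⟹ bound on `ω`, Coppersmith–Winograd tensors.**  For `q ≥ 2`, `k, s ≥ 1`:
`bR(T_{cw,q}^{⊠k}) ≤ r` and `(4^k r^3)^s < q^{k a} 27^{k s}` give `ω(ℂ) < a/s` — the tree's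
`CGLV2022_thm11_cw_borderRank_form` (`ω ≤ log_q((4/27) bR^{3/k})`) evaluated in integers.
[cite: ConnerGesmundoLandsbergVentura2022, Thm. 1.1] -/
theorem soloCW_omega_lt_of_cw_certificate (q k r a s : ℕ) (hq : 2 ≤ q) (hk : 1 ≤ k) (hs : 1 ≤ s)
    (h : algBorderRank (kroneckerPow (cwTensor ℂ q) k) ≤ r)
    (hcert : (4 ^ k * r ^ 3) ^ s < q ^ (k * a) * 27 ^ (k * s)) :
    omega ℂ < (a : ℝ) / s :=
  soloCW_lt_of_logb_certificate hq hk hs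
    (le_trans (by omega) (add_two_le_algBorderRank_kroneckerPow_cwTensor q k hq hk)) h
    (CGLV2022_thm11_cw_borderRank_form q k hq hk) hcert

/-- **Certificate ⟹ bound on `ω`, skew Coppersmith–Winograd tensors** (`q = 2u`, `u, k, s ≥ 1`):
`bR(T_{skewcw,2u}^{⊠k}) ≤ r` and `(4^k r^3)^s < (2u)^{k a} 27^{k s}` give `ω(ℂ) < a/s`, from the
tree's `CGLV2022_skewCw_borderRank_form_holds`. [cite: ConnerGesmundoLandsbergVentura2022, §2.2] -/
theorem soloCW_omega_lt_of_skewCw_certificate (u k r a s : ℕ) (hu : 1 ≤ u) (hk : 1 ≤ k) (hs : 1 ≤ s)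
    (h : algBorderRank (kroneckerPow (skewCwTensor ℂ u) k) ≤ r)
    (hcert : (4 ^ k * r ^ 3) ^ s < (2 * u) ^ (k * a) * 27 ^ (k * s)) :
    omega ℂ < (a : ℝ) / s := by
  have hB : 1 ≤ algBorderRank (kroneckerPow (skewCwTensor ℂ u) k) :=
    le_trans (by omega) (add_three_le_algBorderRank_kroneckerPow_skewCwTensor u k hu hk)
  have hx : omega ℂ ≤ Real.logb ((2 * u : ℕ) : ℝ) ((4 / 27) *
      ((algBorderRank (kroneckerPow (skewCwTensor ℂ u) k) : ℝ) ^ ((3 : ℝ) / k))) := by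
    have hx' := CGLV2022_skewCw_borderRank_form_holds u k hu hk
    push_cast
    exact hx'
  exact soloCW_lt_of_logb_certificate (Q := 2 * u) (by omega) hk hs hB h hx hcert

/-- **The `k = 8` window for `T_{cw,2}` against `2.371177`**: a border-rank decomposition of
`T_{cw,2}^{⊠8}` (format `6561³`) with at most `13029` terms would give `ω(ℂ) < 2.371177`
(certificate `(4^8·13029^3)^326 < 2^6184·27^2608`, i.e. `ω < 773/326`). [folklore] -/
theorem soloCW_window_cw_two_pow_eight
    (h : algBorderRank (kroneckerPow (cwTensor ℂ 2) 8) ≤ 13029) : omega ℂ < 2.371177 :=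
  lt_of_lt_of_le
    (soloCW_omega_lt_of_cw_certificate 2 8 13029 773 326 le_rfl (by norm_num) (by norm_num) h
      (by decide +kernel))
    (by norm_num)

/-- **The `k = 8` window for `T_{cw,2}` against the refereed record `2.371339`** (the tree's
`advxxz2025_omega_le`): `bR(T_{cw,2}^{⊠8}) ≤ 13033 ⟹ ω(ℂ) < 2.371339`
(certificate `(4^8·13033^3)^272 < 2^5160·27^2176`, i.e. `ω < 645/272`). [folklore] -/
theorem soloCW_window_cw_two_pow_eight'
    (h : algBorderRank (kroneckerPow (cwTensor ℂ 2) 8) ≤ 13033) : omega ℂ < 2.371339 :=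
  lt_of_lt_of_le
    (soloCW_omega_lt_of_cw_certificate 2 8 13033 645 272 le_rfl (by norm_num) (by norm_num) h
      (by decide +kernel))
    (by norm_num)

/-- **The `k = 8` window for `T_{skewcw,2}`**: `bR(T_{skewcw,2}^{⊠8}) ≤ 13029 ⟹ ω(ℂ) < 2.371177`
(same certificate, base `q = 2 = 2·1`). [folklore] -/
theorem soloCW_window_skewCw_two_pow_eight
    (h : algBorderRank (kroneckerPow (skewCwTensor ℂ 1) 8) ≤ 13029) : omega ℂ < 2.371177 :=
  lt_of_lt_of_le
    (soloCW_omega_lt_of_skewCw_certificate 1 8 13029 773 326 le_rfl (by norm_num) (by norm_num) h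
      (by decide +kernel))
    (by norm_num)


end Summit.MatrixMultiplication.MatrixMultiplication.Theorems

end
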